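import Literature.Topology.FourManifolds.GluedProductMaps
import Literature.Topology.FourManifolds.ConnectedSumInclusionPackage
import Literature.Geometry.Manifold.ThreePiecePatching
import Literature.Geometry.Manifold.OpenEmbeddingCriterion
import Mathlib.Analysis.SpecialFunctions.SmoothTransition
import HarnessLib

/-!
# Descent of the two sheets to the tube of `Σ̄₂ = T # T′` in `Z = T⁴ # ℂℙ²bar`

Topic `Literature/Topology/FourManifolds` (fact seat of the Seiberg–Witten leaf
`Literature.Barriers.SmoothPoincare4.akhmedovPark2010_lemma8_invariants`; block 2 of
Akhmedov–Park's `X₁(m)`, A. Akhmedov, B. D. Park, Invent. Math. 181 (2010), §3).  The genus-2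
surface `Σ̄₂` is the Kervaire–Milnor sum `F = T # T′` of the two tori along the datum `D_F`
(`SigmaBarSheetTwo.lean`); its tube is obtained by DESCENDING the two sheets
`ΦA : T × ℝ² → Z` (`SigmaBarSheetOne.lean`), `ΦB : T′ × ℝ² → Z` (`SigmaBarSheetTwo.lean`),
compatible along the glue (`ΦB (w, ·) = ΦA (Φ_F⁻¹ w, ·)` on the glue zone), to
`F × ℝ² = (T ∖ {x₂} ⊔ T′ ∖ {y₂})/∼ × ℝ²` (`GluedProductMaps.lean`) and shrinking the fibre
`ℝ² → B(0, ρ₀)` by `univBall`.  With the two sheets bound by hypotheses — smooth on the punctured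
tori times `B(0, ρ₀)`, the first injective with open images and a smooth left inverse, the second
injective OFF the glue zone with local inverse data, their images disjoint off the glue zone — the
result is a smooth embedding `TZ : F × ℝ² → Z` with open range
(`exists_glued_tube`; the criterion `isSmoothEmbedding_of_leftInverse_of_isOpenMap`), with
`TZ (inl a, v) = ΦA (a, σ v)`, `TZ (inr b, v) = ΦB (b, σ v)` (`σ = univBall 0 ρ₀`) and
`range TZ = ΦA ((T ∖ {x₂}) × B) ∪ ΦB ((T′ ∖ {y₂}) × B)`.  Everything is proved; no definitions.

## References

* A. Akhmedov, B. D. Park, Invent. Math. 181 (2010) 577–603 = arXiv:math/0701829, §3. [AkhmedovPark2010]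
* A. Kosinski, *Differential Manifolds* (1993), Ch. VI §1. [Kosinski1993]
* J. M. Lee, *Introduction to Smooth Manifolds*, 2nd ed. (2013), Prop. 4.22, Prop. 5.2. [LeeSmoothManifolds2013]
-/

noncomputable section

open scoped Manifold ContDiff Topology
open Set Function Metric
open Literature.Geometry.Manifold

namespace Literature.Topology.FourManifolds

namespace TubeDescent

variable {F : Type} [TopologicalSpace F] [T2Space F] [ChartedSpace (EuclideanSpace ℝ (Fin 2)) F]
  [IsManifold (𝓡 2) ∞ F]
  {F' : Type} [TopologicalSpace F'] [T2Space F'] [ChartedSpace (EuclideanSpace ℝ (Fin 2)) F']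
  [IsManifold (𝓡 2) ∞ F']
  {Z : Type} [TopologicalSpace Z] [ChartedSpace (EuclideanSpace ℝ (Fin 4)) Z] [IsManifold (𝓡 4) ∞ Z]
  {DF : ConnectedSumData 2 F F'} {hn : (2 : ℕ) ≠ 0}
  {ΦA : F × EuclideanSpace ℝ (Fin 2) → Z} {ΦB : F' × EuclideanSpace ℝ (Fin 2) → Z}
  {x₂ : F} {y₂ : F'} {ρ₀ : ℝ} {UG : Set F'} {V₂ V₃ : Set (F' × EuclideanSpace ℝ (Fin 2))}
  {TZ₀ : DF.Glued hn × EuclideanSpace ℝ (Fin 2) → Z}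

variable (hρ₀ : 0 < ρ₀) (hi₁ : DF.i₁ 0 = x₂) (hi₂ : DF.i₂ 0 = y₂) (hUG : UG = DF.Φ.target)
  (hΦAs : ContMDiffOn ((𝓡 2).prod (𝓡 2)) (𝓡 4) ∞ ΦA
    ({p | p ≠ x₂} ×ˢ ball (0 : EuclideanSpace ℝ (Fin 2)) ρ₀))
  (hΦAi : InjOn ΦA ({p | p ≠ x₂} ×ˢ ball (0 : EuclideanSpace ℝ (Fin 2)) ρ₀))
  (hΦAo : ∀ O, IsOpen O → O ⊆ {p | p ≠ x₂} ×ˢ ball (0 : EuclideanSpace ℝ (Fin 2)) ρ₀ → IsOpen (ΦA '' O))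
  (hΦBs : ContMDiffOn ((𝓡 2).prod (𝓡 2)) (𝓡 4) ∞ ΦB
    ({w | w ≠ y₂} ×ˢ ball (0 : EuclideanSpace ℝ (Fin 2)) ρ₀))
  (hΦBo : ∀ O, IsOpen O → O ⊆ {w | w ≠ y₂} ×ˢ ball (0 : EuclideanSpace ℝ (Fin 2)) ρ₀ → IsOpen (ΦB '' O))
  (hΦBG : ∀ w ∈ UG, ∀ v : EuclideanSpace ℝ (Fin 2), ΦB (w, v) = ΦA (DF.Φ.symm w, v))
  (hΦBi : InjOn ΦB ({w | w ≠ y₂ ∧ w ∉ UG} ×ˢ ball (0 : EuclideanSpace ℝ (Fin 2)) ρ₀))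
  (hdisj : ∀ p, p ≠ x₂ → ∀ v : EuclideanSpace ℝ (Fin 2), ‖v‖ < ρ₀ → ∀ w, w ≠ y₂ → w ∉ UG →
    ∀ v' : EuclideanSpace ℝ (Fin 2), ‖v'‖ < ρ₀ → ΦA (p, v) ≠ ΦB (w, v'))
  (hTA : ∀ (a : DF.A) (v : EuclideanSpace ℝ (Fin 2)), TZ₀ ((DF.glueData hn).inl a, v) = ΦA (a, v))
  (hTB : ∀ (b : DF.B) (v : EuclideanSpace ℝ (Fin 2)), TZ₀ ((DF.glueData hn).inr b, v) = ΦB (b, v))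

/-! ### §1 The uncurried descended map -/

omit [T2Space F] [IsManifold (𝓡 2) ∞ F] [T2Space F'] [IsManifold (𝓡 2) ∞ F'] [TopologicalSpace Z]
  [ChartedSpace (EuclideanSpace ℝ (Fin 4)) Z] [IsManifold (𝓡 4) ∞ Z] in
include hUG hΦBG in
/-- **The two sheets descend**: there is `TZ₀ : F × ℝ² → Z` with `TZ₀ (inl a, v) = ΦA (a, v)` and
`TZ₀ (inr b, v) = ΦB (b, v)`. [cite: Kosinski1993, Ch. VI §1] -/
theorem exists_TZ₀ [T2Space F] [T2Space F'] :
    ∃ TZ₀ : DF.Glued hn × EuclideanSpace ℝ (Fin 2) → Z,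
      (∀ (a : DF.A) (v : EuclideanSpace ℝ (Fin 2)), TZ₀ ((DF.glueData hn).inl a, v) = ΦA (a, v)) ∧
      (∀ (b : DF.B) (v : EuclideanSpace ℝ (Fin 2)), TZ₀ ((DF.glueData hn).inr b, v) = ΦB (b, v)) := by
  have hcompat : ∀ a : DF.A, a ∈ (DF.glueData hn).glue.source →
      (fun v : EuclideanSpace ℝ (Fin 2) => ΦA (a, v)) =
        fun v => ΦB (((DF.glueData hn).glue a : DF.B), v) := by
    intro a ha
    rw [ConnectedSumData.glueData_glue] at ha ⊢
    have ha' : (a : F) ∈ DF.Φ.source := (DF.mem_φ_source hn).1 ha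
    funext v
    rw [DF.coe_φ hn ha, hΦBG _ (by rw [hUG]; exact DF.Φ.map_source ha') v, DF.Φ.left_inv ha']
  refine ⟨fun z => (DF.glueData hn).desc (fun a v => ΦA (a, v)) (fun b v => ΦB (b, v)) hcompat z.1 z.2,
    fun a v => ?_, fun b v => ?_⟩
  · exact (DF.glueData hn).desc_prod_apply_inl hcompat a v
  · exact (DF.glueData hn).desc_prod_apply_inr hcompat b v

omit [IsManifold (𝓡 2) ∞ F] [IsManifold (𝓡 2) ∞ F'] [TopologicalSpace Z]
  [ChartedSpace (EuclideanSpace ℝ (Fin 4)) Z] [IsManifold (𝓡 4) ∞ Z] in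
include hi₁ hi₂ in
/-- Membership in the two punctured pieces: `(DF.A : Set F) = {p ≠ x₂}`, `(DF.B : Set F′) = {w ≠ y₂}`.
[folklore] -/
theorem mem_pieces (p : F) (w : F') :
    (p ∈ (DF.A : Set F) ↔ p ≠ x₂) ∧ (w ∈ (DF.B : Set F') ↔ w ≠ y₂) := by
  obtain ⟨h1, h2⟩ := DF.mem_A_iff_ne p w
  rw [hi₁] at h1; rw [hi₂] at h2
  exact ⟨h1, h2⟩

omit [IsManifold (𝓡 2) ∞ F] [IsManifold (𝓡 2) ∞ F'] [TopologicalSpace Z]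
  [ChartedSpace (EuclideanSpace ℝ (Fin 4)) Z] [IsManifold (𝓡 4) ∞ Z] in
include hUG in
/-- **A second-piece point over the glue zone is a first-piece point**: for `b : DF.B` with
`(b : F′) ∈ U_G` there is `a : DF.A`, `a = Φ_F⁻¹ b`, with `inr b = inl a`. [cite: KervaireMilnor1963, §2] -/
theorem inr_eq_inl_of_mem_UG {b : DF.B} (hb : (b : F') ∈ UG) :
    ∃ a : DF.A, (a : F) = DF.Φ.symm b ∧ (DF.glueData hn).inr b = (DF.glueData hn).inl a := by
  rw [hUG] at hb
  have hsrc : DF.Φ.symm b ∈ DF.Φ.source := DF.Φ.map_target hb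
  refine ⟨⟨DF.Φ.symm b, DF.Φ_source_subset hsrc⟩, rfl, ?_⟩
  symm
  rw [(DF.glueData hn).inl_eq_inr_iff, ConnectedSumData.glueData_glue]
  have ha : (⟨DF.Φ.symm b, DF.Φ_source_subset hsrc⟩ : DF.A) ∈ (DF.φ hn).source :=
    (DF.mem_φ_source hn).2 hsrc
  refine ⟨ha, Subtype.ext ?_⟩
  rw [DF.coe_φ hn ha]
  exact DF.Φ.right_inv hb

/-! ### §2 Smoothness, injectivity, open images, left inverse of `TZ₀` on `F × B(0, ρ₀)` -/

include hi₁ hi₂ hΦAs hΦBs hTA hTB in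
/-- **`TZ₀` is smooth on `F × B(0, ρ₀)`.** [cite: Kosinski1993, Ch. VI §1] -/
theorem contMDiffOn_TZ₀ :
    ContMDiffOn ((𝓘(ℝ, EuclideanSpace ℝ (Fin 2))).prod (𝓡 2)) (𝓡 4) ∞ TZ₀
      ((univ : Set (DF.Glued hn)) ×ˢ ball (0 : EuclideanSpace ℝ (Fin 2)) ρ₀) := by
  have hmem := mem_pieces (DF := DF) hi₁ hi₂
  refine (DF.glueData hn).contMDiffOn_glued_prod_of_comp (I_V := 𝓡 2) (isOpen_univ.prod isOpen_ball) ?_ ?_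
  · -- first piece: `(a, v) ↦ ΦA (a, v)`
    have hval : ContMDiff ((𝓡 2).prod (𝓡 2)) ((𝓡 2).prod (𝓡 2)) ∞
        (fun q : DF.A × EuclideanSpace ℝ (Fin 2) => ((q.1 : F), q.2)) :=
      contMDiff_subtype_val.prodMap contMDiff_id
    have h := hΦAs.comp hval.contMDiffOn (s := {q : DF.A × EuclideanSpace ℝ (Fin 2) |
        q.2 ∈ ball (0 : EuclideanSpace ℝ (Fin 2)) ρ₀})
      (fun q hq => ⟨(hmem q.1 (DF.i₂ 0)).1.1 q.1.2, hq⟩)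
    refine (h.congr fun q _ => hTA q.1 q.2).mono ?_
    rintro q ⟨-, hq⟩; exact hq
  · have hval : ContMDiff ((𝓡 2).prod (𝓡 2)) ((𝓡 2).prod (𝓡 2)) ∞
        (fun q : DF.B × EuclideanSpace ℝ (Fin 2) => ((q.1 : F'), q.2)) :=
      contMDiff_subtype_val.prodMap contMDiff_id
    have h := hΦBs.comp hval.contMDiffOn (s := {q : DF.B × EuclideanSpace ℝ (Fin 2) |
        q.2 ∈ ball (0 : EuclideanSpace ℝ (Fin 2)) ρ₀})
      (fun q hq => ⟨(hmem (DF.i₁ 0) q.1).2.1 q.1.2, hq⟩)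
    refine (h.congr fun q _ => hTB q.1 q.2).mono ?_
    rintro q ⟨-, hq⟩; exact hq

omit [IsManifold (𝓡 2) ∞ F] [IsManifold (𝓡 2) ∞ F'] [TopologicalSpace Z]
  [ChartedSpace (EuclideanSpace ℝ (Fin 4)) Z] [IsManifold (𝓡 4) ∞ Z] in
include hi₁ hi₂ hUG hΦAi hΦBi hdisj hTA hTB in
/-- **`TZ₀` is injective on `F × B(0, ρ₀)`.**  Every point of `F` is `inl a` or `inr b` with
`b ∉ U_G` (`inr_eq_inl_of_mem_UG`); then use the injectivity of the first sheet, of the second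
sheet off the glue zone, and the disjointness of their images. [cite: AkhmedovPark2010, §3] -/
theorem injOn_TZ₀ :
    InjOn TZ₀ ((univ : Set (DF.Glued hn)) ×ˢ ball (0 : EuclideanSpace ℝ (Fin 2)) ρ₀) := by
  have hmem := mem_pieces (DF := DF) hi₁ hi₂
  -- normal form of a point
  have hnf : ∀ g : DF.Glued hn, (∃ a : DF.A, g = (DF.glueData hn).inl a) ∨
      ∃ b : DF.B, (b : F') ∉ UG ∧ g = (DF.glueData hn).inr b := by
    intro g
    rcases (DF.glueData hn).exists_inl_or_inr g with ⟨a, rfl⟩ | ⟨b, rfl⟩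
    · exact Or.inl ⟨a, rfl⟩
    · by_cases hb : (b : F') ∈ UG
      · obtain ⟨a, -, ha⟩ := inr_eq_inl_of_mem_UG (hn := hn) hUG hb
        exact Or.inl ⟨a, ha⟩
      · exact Or.inr ⟨b, hb, rfl⟩
  rintro ⟨g, v⟩ ⟨-, hv⟩ ⟨g', v'⟩ ⟨-, hv'⟩ h
  have hvn := mem_ball_zero_iff.1 hv
  have hvn' := mem_ball_zero_iff.1 hv'
  rcases hnf g with ⟨a, rfl⟩ | ⟨b, hb, rfl⟩ <;> rcases hnf g' with ⟨a', rfl⟩ | ⟨b', hb', rfl⟩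
  · rw [hTA, hTA] at h
    have ha2 : (a : F) ≠ x₂ := (hmem a (DF.i₂ 0)).1.1 a.2
    have ha2' : (a' : F) ≠ x₂ := (hmem a' (DF.i₂ 0)).1.1 a'.2
    obtain ⟨h1, h2⟩ := Prod.mk.inj (hΦAi
      (show ((a : F), v) ∈ {p | p ≠ x₂} ×ˢ ball (0 : EuclideanSpace ℝ (Fin 2)) ρ₀ from ⟨ha2, hv⟩)
      (show ((a' : F), v') ∈ {p | p ≠ x₂} ×ˢ ball (0 : EuclideanSpace ℝ (Fin 2)) ρ₀ from ⟨ha2', hv'⟩) h)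
    rw [Subtype.ext h1, h2]
  · rw [hTA, hTB] at h
    exact absurd h (hdisj _ ((hmem a (DF.i₂ 0)).1.1 a.2) v hvn _ ((hmem (DF.i₁ 0) b').2.1 b'.2) hb'
      v' hvn')
  · rw [hTB, hTA] at h
    exact absurd h.symm (hdisj _ ((hmem a' (DF.i₂ 0)).1.1 a'.2) v' hvn' _
      ((hmem (DF.i₁ 0) b).2.1 b.2) hb v hvn)
  · rw [hTB, hTB] at h
    obtain ⟨h1, h2⟩ := Prod.mk.inj (hΦBi
      (show ((b : F'), v) ∈ {w | w ≠ y₂ ∧ w ∉ UG} ×ˢ ball (0 : EuclideanSpace ℝ (Fin 2)) ρ₀ from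
        ⟨⟨(hmem (DF.i₁ 0) b).2.1 b.2, hb⟩, hv⟩)
      (show ((b' : F'), v') ∈ {w | w ≠ y₂ ∧ w ∉ UG} ×ˢ ball (0 : EuclideanSpace ℝ (Fin 2)) ρ₀ from
        ⟨⟨(hmem (DF.i₁ 0) b').2.1 b'.2, hb'⟩, hv'⟩) h)
    rw [Subtype.ext h1, h2]

omit [IsManifold (𝓡 2) ∞ F] [IsManifold (𝓡 2) ∞ F'] [ChartedSpace (EuclideanSpace ℝ (Fin 4)) Z]
  [IsManifold (𝓡 4) ∞ Z] in
include hi₁ hi₂ hΦAo hΦBo hTA hTB in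
/-- **The image of an open subset of `F × B(0, ρ₀)` under `TZ₀` is open**; and it is the union
`ΦA (O_A) ∪ ΦB (O_B)` of the images of its two open lifts. [cite: LeeSmoothManifolds2013, Prop. 4.22] -/
theorem isOpen_image_TZ₀ {O : Set (DF.Glued hn × EuclideanSpace ℝ (Fin 2))} (hO : IsOpen O)
    (hOS : O ⊆ (univ : Set (DF.Glued hn)) ×ˢ ball (0 : EuclideanSpace ℝ (Fin 2)) ρ₀) :
    IsOpen (TZ₀ '' O) ∧
      TZ₀ '' O = ΦA '' ((fun q : DF.A × EuclideanSpace ℝ (Fin 2) => ((q.1 : F), q.2)) ''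
          ((fun q : DF.A × EuclideanSpace ℝ (Fin 2) => ((DF.glueData hn).inl q.1, q.2)) ⁻¹' O)) ∪
        ΦB '' ((fun q : DF.B × EuclideanSpace ℝ (Fin 2) => ((q.1 : F'), q.2)) ''
          ((fun q : DF.B × EuclideanSpace ℝ (Fin 2) => ((DF.glueData hn).inr q.1, q.2)) ⁻¹' O)) := by
  have hmem := mem_pieces (DF := DF) hi₁ hi₂
  set d := DF.glueData hn with hd
  have heq : TZ₀ '' O = ΦA '' ((fun q : DF.A × EuclideanSpace ℝ (Fin 2) => ((q.1 : F), q.2)) ''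
          ((fun q : DF.A × EuclideanSpace ℝ (Fin 2) => (d.inl q.1, q.2)) ⁻¹' O)) ∪
        ΦB '' ((fun q : DF.B × EuclideanSpace ℝ (Fin 2) => ((q.1 : F'), q.2)) ''
          ((fun q : DF.B × EuclideanSpace ℝ (Fin 2) => (d.inr q.1, q.2)) ⁻¹' O)) := by
    apply Subset.antisymm
    · rintro _ ⟨⟨g, v⟩, hg, rfl⟩
      rcases d.exists_inl_or_inr g with ⟨a, rfl⟩ | ⟨b, rfl⟩
      · exact Or.inl ⟨((a : F), v), ⟨(a, v), hg, rfl⟩, (hTA a v).symm⟩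
      · exact Or.inr ⟨((b : F'), v), ⟨(b, v), hg, rfl⟩, (hTB b v).symm⟩
    · rintro z (⟨_, ⟨⟨a, v⟩, hq, rfl⟩, rfl⟩ | ⟨_, ⟨⟨b, v⟩, hq, rfl⟩, rfl⟩)
      · exact ⟨_, hq, hTA a v⟩
      · exact ⟨_, hq, hTB b v⟩
  refine ⟨?_, heq⟩
  rw [heq]
  have hcA : Continuous (fun q : DF.A × EuclideanSpace ℝ (Fin 2) => (d.inl q.1, q.2)) :=
    d.isOpenEmbedding_inl.continuous.prodMap continuous_id
  have hcB : Continuous (fun q : DF.B × EuclideanSpace ℝ (Fin 2) => (d.inr q.1, q.2)) :=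
    d.isOpenEmbedding_inr.continuous.prodMap continuous_id
  have hoeA : Topology.IsOpenEmbedding (fun q : DF.A × EuclideanSpace ℝ (Fin 2) => ((q.1 : F), q.2)) :=
    (DF.A.2.isOpenEmbedding_subtypeVal).prodMap Topology.IsOpenEmbedding.id
  have hoeB : Topology.IsOpenEmbedding (fun q : DF.B × EuclideanSpace ℝ (Fin 2) => ((q.1 : F'), q.2)) :=
    (DF.B.2.isOpenEmbedding_subtypeVal).prodMap Topology.IsOpenEmbedding.id
  refine (hΦAo _ (hoeA.isOpenMap _ (hO.preimage hcA)) ?_).union (hΦBo _ (hoeB.isOpenMap _ (hO.preimage hcB)) ?_)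
  · rintro _ ⟨⟨a, v⟩, hq, rfl⟩
    exact ⟨(hmem a (DF.i₂ 0)).1.1 a.2, (hOS hq).2⟩
  · rintro _ ⟨⟨b, v⟩, hq, rfl⟩
    exact ⟨(hmem (DF.i₁ 0) b).2.1 b.2, (hOS hq).2⟩

omit [IsManifold (𝓡 4) ∞ Z] in
include hi₁ hi₂ hUG hΦAi hΦAo hΦBo hΦBi hdisj hTA hTB in
/-- **A smooth left inverse of `TZ₀` on its image**, patched from a left inverse of the first
sheet (followed by `inl`) and the local inverses of the second sheet off the glue zone (followed
by `inr`). [cite: LeeSmoothManifolds2013, Prop. 5.2] -/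
theorem exists_inverse_TZ₀
    {rA : Z → F × EuclideanSpace ℝ (Fin 2)}
    (hrA : ContMDiffOn (𝓡 4) ((𝓡 2).prod (𝓡 2)) ∞ rA
      (ΦA '' ({p | p ≠ x₂} ×ˢ ball (0 : EuclideanSpace ℝ (Fin 2)) ρ₀)))
    (hrAl : ∀ q ∈ {p | p ≠ x₂} ×ˢ ball (0 : EuclideanSpace ℝ (Fin 2)) ρ₀, rA (ΦA q) = q)
    (hV₂ : IsOpen V₂) (hV₃ : IsOpen V₃)
    (hV₂S : V₂ ⊆ {w | w ≠ y₂} ×ˢ ball (0 : EuclideanSpace ℝ (Fin 2)) ρ₀)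
    (hV₃S : V₃ ⊆ {w | w ≠ y₂} ×ˢ ball (0 : EuclideanSpace ℝ (Fin 2)) ρ₀)
    {r₂ r₃ : Z → F' × EuclideanSpace ℝ (Fin 2)}
    (hr₂ : ContMDiffOn (𝓡 4) ((𝓡 2).prod (𝓡 2)) ∞ r₂ (ΦB '' V₂)) (hr₂l : ∀ q ∈ V₂, r₂ (ΦB q) = q)
    (hr₃ : ContMDiffOn (𝓡 4) ((𝓡 2).prod (𝓡 2)) ∞ r₃ (ΦB '' V₃)) (hr₃l : ∀ q ∈ V₃, r₃ (ΦB q) = q)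
    (hcoverB : ∀ q : F' × EuclideanSpace ℝ (Fin 2), q.1 ≠ y₂ → ‖q.2‖ < ρ₀ →
      q.1 ∈ UG ∨ q ∈ V₂ ∨ q ∈ V₃) :
    ∃ r : Z → DF.Glued hn × EuclideanSpace ℝ (Fin 2),
      ContMDiffOn (𝓡 4) ((𝓘(ℝ, EuclideanSpace ℝ (Fin 2))).prod (𝓡 2)) ∞ r
        (TZ₀ '' ((univ : Set (DF.Glued hn)) ×ˢ ball (0 : EuclideanSpace ℝ (Fin 2)) ρ₀)) ∧
      ∀ z ∈ (univ : Set (DF.Glued hn)) ×ˢ ball (0 : EuclideanSpace ℝ (Fin 2)) ρ₀, r (TZ₀ z) = z := by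
  classical
  have hmem := mem_pieces (DF := DF) hi₁ hi₂
  haveI : Nonempty (DF.Glued hn × EuclideanSpace ℝ (Fin 2)) := by
    obtain ⟨a₀⟩ := DF.nonempty_A hn
    exact ⟨((DF.glueData hn).inl a₀, 0)⟩
  have hinj := injOn_TZ₀ hi₁ hi₂ hUG hΦAi hΦBi hdisj hTA hTB
  -- the inclusions of the two tori into `F`
  obtain ⟨jF, jF', -, -, hjF, hjF', ⟨hjFs, -, -, -, -⟩, ⟨hjF's, -, -, -, -⟩, -, -, -⟩ :=
    DF.exists_inclusion_package hn
  set S : Set (DF.Glued hn × EuclideanSpace ℝ (Fin 2)) :=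
    (univ : Set (DF.Glued hn)) ×ˢ ball (0 : EuclideanSpace ℝ (Fin 2)) ρ₀ with hS
  -- the three domain pieces
  set U₁ : Set (DF.Glued hn × EuclideanSpace ℝ (Fin 2)) :=
    (fun q : DF.A × EuclideanSpace ℝ (Fin 2) => ((DF.glueData hn).inl q.1, q.2)) ''
      ((univ : Set DF.A) ×ˢ ball (0 : EuclideanSpace ℝ (Fin 2)) ρ₀) with hU₁
  set U₂ : Set (DF.Glued hn × EuclideanSpace ℝ (Fin 2)) :=
    (fun q : DF.B × EuclideanSpace ℝ (Fin 2) => ((DF.glueData hn).inr q.1, q.2)) ''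
      ((fun q : DF.B × EuclideanSpace ℝ (Fin 2) => ((q.1 : F'), q.2)) ⁻¹' V₂) with hU₂
  set U₃ : Set (DF.Glued hn × EuclideanSpace ℝ (Fin 2)) :=
    (fun q : DF.B × EuclideanSpace ℝ (Fin 2) => ((DF.glueData hn).inr q.1, q.2)) ''
      ((fun q : DF.B × EuclideanSpace ℝ (Fin 2) => ((q.1 : F'), q.2)) ⁻¹' V₃) with hU₃
  have hU₁S : U₁ ⊆ S := by rintro _ ⟨⟨a, v⟩, ⟨-, hv⟩, rfl⟩; exact ⟨mem_univ _, hv⟩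
  have hU₂S : U₂ ⊆ S := by rintro _ ⟨⟨b, v⟩, hq, rfl⟩; exact ⟨mem_univ _, (hV₂S hq).2⟩
  have hU₃S : U₃ ⊆ S := by rintro _ ⟨⟨b, v⟩, hq, rfl⟩; exact ⟨mem_univ _, (hV₃S hq).2⟩
  have hcover : S ⊆ U₁ ∪ U₂ ∪ U₃ := by
    rintro ⟨g, v⟩ ⟨-, hv⟩
    rcases (DF.glueData hn).exists_inl_or_inr g with ⟨a, rfl⟩ | ⟨b, rfl⟩
    · exact Or.inl (Or.inl ⟨(a, v), ⟨mem_univ _, hv⟩, rfl⟩)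
    · rcases hcoverB ((b : F'), v) ((hmem (DF.i₁ 0) b).2.1 b.2) (mem_ball_zero_iff.1 hv) with h | h | h
      · obtain ⟨a, -, ha⟩ := inr_eq_inl_of_mem_UG (hn := hn) hUG h
        refine Or.inl (Or.inl ⟨(a, v), ⟨mem_univ _, hv⟩, ?_⟩)
        show ((DF.glueData hn).inl a, v) = ((DF.glueData hn).inr b, v)
        rw [ha]
      · exact Or.inl (Or.inr ⟨(b, v), h, rfl⟩)
      · exact Or.inr ⟨(b, v), h, rfl⟩
  -- images of the pieces
  have himg₁ : TZ₀ '' U₁ = ΦA '' ({p | p ≠ x₂} ×ˢ ball (0 : EuclideanSpace ℝ (Fin 2)) ρ₀) := by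
    apply Subset.antisymm
    · rintro _ ⟨_, ⟨⟨a, v⟩, ⟨-, hv⟩, rfl⟩, rfl⟩
      exact ⟨((a : F), v),
        (show ((a : F), v) ∈ {p | p ≠ x₂} ×ˢ ball (0 : EuclideanSpace ℝ (Fin 2)) ρ₀ from
          ⟨(hmem a (DF.i₂ 0)).1.1 a.2, hv⟩), (hTA a v).symm⟩
    · rintro _ ⟨⟨p, v⟩, ⟨hp, hv⟩, rfl⟩
      exact ⟨((DF.glueData hn).inl ⟨p, (hmem p (DF.i₂ 0)).1.2 hp⟩, v), ⟨(⟨p, (hmem p (DF.i₂ 0)).1.2 hp⟩, v), ⟨mem_univ _, hv⟩, rfl⟩,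
        hTA _ v⟩
  have himgB : ∀ {V : Set (F' × EuclideanSpace ℝ (Fin 2))}, V ⊆ {w | w ≠ y₂} ×ˢ ball (0 : EuclideanSpace ℝ (Fin 2)) ρ₀ →
      TZ₀ '' ((fun q : DF.B × EuclideanSpace ℝ (Fin 2) => ((DF.glueData hn).inr q.1, q.2)) ''
        ((fun q : DF.B × EuclideanSpace ℝ (Fin 2) => ((q.1 : F'), q.2)) ⁻¹' V)) = ΦB '' V := by
    intro V hVS
    apply Subset.antisymm
    · rintro _ ⟨_, ⟨⟨b, v⟩, hq, rfl⟩, rfl⟩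
      exact ⟨((b : F'), v), hq, (hTB b v).symm⟩
    · rintro _ ⟨⟨w, v⟩, hq, rfl⟩
      have hw : w ∈ (DF.B : Set F') := (hmem (DF.i₁ 0) w).2.2 (hVS hq).1
      exact ⟨((DF.glueData hn).inr ⟨w, hw⟩, v), ⟨(⟨w, hw⟩, v), hq, rfl⟩, hTB _ v⟩
  -- openness of the images
  have hoS : ∀ {U}, U ⊆ S → IsOpen U → IsOpen (TZ₀ '' U) := fun hUS hU =>
    (isOpen_image_TZ₀ hi₁ hi₂ hΦAo hΦBo hTA hTB hU hUS).1
  have hoeA : Topology.IsOpenEmbedding (fun q : DF.A × EuclideanSpace ℝ (Fin 2) => ((DF.glueData hn).inl q.1, q.2)) := by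
    obtain ⟨h1, h2, -, -, -⟩ := (DF.glueData hn).isOpenGluing_prod (I_V := 𝓡 2) (V := EuclideanSpace ℝ (Fin 2))
    exact ⟨h1.isEmbedding, h2⟩
  have hoeB : Topology.IsOpenEmbedding (fun q : DF.B × EuclideanSpace ℝ (Fin 2) => ((DF.glueData hn).inr q.1, q.2)) := by
    obtain ⟨-, -, h3, h4, -⟩ := (DF.glueData hn).isOpenGluing_prod (I_V := 𝓡 2) (V := EuclideanSpace ℝ (Fin 2))
    exact ⟨h3.isEmbedding, h4⟩
  have hcvalB : Continuous (fun q : DF.B × EuclideanSpace ℝ (Fin 2) => ((q.1 : F'), q.2)) :=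
    continuous_subtype_val.prodMap continuous_id
  have hU₁o : IsOpen U₁ := hoeA.isOpenMap _ (isOpen_univ.prod isOpen_ball)
  have hU₂o : IsOpen U₂ := hoeB.isOpenMap _ (hV₂.preimage hcvalB)
  have hU₃o : IsOpen U₃ := hoeB.isOpenMap _ (hV₃.preimage hcvalB)
  -- the three local inverses
  have hr₁ : ContMDiffOn (𝓡 4) ((𝓘(ℝ, EuclideanSpace ℝ (Fin 2))).prod (𝓡 2)) ∞
      ((fun q : F × EuclideanSpace ℝ (Fin 2) => (jF q.1, q.2)) ∘ rA) (TZ₀ '' U₁) := by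
    rw [himg₁]
    have hj : ContMDiffOn ((𝓡 2).prod (𝓡 2)) ((𝓘(ℝ, EuclideanSpace ℝ (Fin 2))).prod (𝓡 2)) ∞
        (fun q : F × EuclideanSpace ℝ (Fin 2) => (jF q.1, q.2))
        ((DF.A : Set F) ×ˢ (univ : Set (EuclideanSpace ℝ (Fin 2)))) :=
      hjFs.prodMap contMDiffOn_id
    refine hj.comp hrA ?_
    rintro _ ⟨q, hq, rfl⟩
    rw [mem_preimage, hrAl q hq]
    exact ⟨(hmem q.1 (DF.i₂ 0)).1.2 hq.1, mem_univ _⟩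
  have hr₁l : ∀ z ∈ U₁, ((fun q : F × EuclideanSpace ℝ (Fin 2) => (jF q.1, q.2)) ∘ rA) (TZ₀ z) = z := by
    rintro _ ⟨⟨a, v⟩, ⟨-, hv⟩, rfl⟩
    show (jF (rA (TZ₀ ((DF.glueData hn).inl a, v))).1, (rA (TZ₀ ((DF.glueData hn).inl a, v))).2) = ((DF.glueData hn).inl a, v)
    rw [hTA, hrAl _ (show ((a : F), v) ∈ {p | p ≠ x₂} ×ˢ ball (0 : EuclideanSpace ℝ (Fin 2)) ρ₀ from
      ⟨(hmem a (DF.i₂ 0)).1.1 a.2, hv⟩), hjF _ a.2]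
  have hrB : ∀ {V : Set (F' × EuclideanSpace ℝ (Fin 2))} {rV : Z → F' × EuclideanSpace ℝ (Fin 2)},
      V ⊆ {w | w ≠ y₂} ×ˢ ball (0 : EuclideanSpace ℝ (Fin 2)) ρ₀ →
      ContMDiffOn (𝓡 4) ((𝓡 2).prod (𝓡 2)) ∞ rV (ΦB '' V) → (∀ q ∈ V, rV (ΦB q) = q) →
      ContMDiffOn (𝓡 4) ((𝓘(ℝ, EuclideanSpace ℝ (Fin 2))).prod (𝓡 2)) ∞
        ((fun q : F' × EuclideanSpace ℝ (Fin 2) => (jF' q.1, q.2)) ∘ rV)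
        (TZ₀ '' ((fun q : DF.B × EuclideanSpace ℝ (Fin 2) => ((DF.glueData hn).inr q.1, q.2)) ''
          ((fun q : DF.B × EuclideanSpace ℝ (Fin 2) => ((q.1 : F'), q.2)) ⁻¹' V))) ∧
      ∀ z ∈ (fun q : DF.B × EuclideanSpace ℝ (Fin 2) => ((DF.glueData hn).inr q.1, q.2)) ''
          ((fun q : DF.B × EuclideanSpace ℝ (Fin 2) => ((q.1 : F'), q.2)) ⁻¹' V),
        ((fun q : F' × EuclideanSpace ℝ (Fin 2) => (jF' q.1, q.2)) ∘ rV) (TZ₀ z) = z := by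
    intro V rV hVS hrV hrVl
    constructor
    · rw [himgB hVS]
      have hj : ContMDiffOn ((𝓡 2).prod (𝓡 2)) ((𝓘(ℝ, EuclideanSpace ℝ (Fin 2))).prod (𝓡 2)) ∞
          (fun q : F' × EuclideanSpace ℝ (Fin 2) => (jF' q.1, q.2))
          ((DF.B : Set F') ×ˢ (univ : Set (EuclideanSpace ℝ (Fin 2)))) :=
        hjF's.prodMap contMDiffOn_id
      refine hj.comp hrV ?_
      rintro _ ⟨q, hq, rfl⟩
      rw [mem_preimage, hrVl q hq]
      exact ⟨(hmem (DF.i₁ 0) q.1).2.2 (hVS hq).1, mem_univ _⟩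
    · rintro _ ⟨⟨b, v⟩, hq, rfl⟩
      show (jF' (rV (TZ₀ ((DF.glueData hn).inr b, v))).1, (rV (TZ₀ ((DF.glueData hn).inr b, v))).2) = ((DF.glueData hn).inr b, v)
      rw [hTB, hrVl _ hq, hjF' _ b.2]
  obtain ⟨hr₂', hr₂l'⟩ := hrB hV₂S hr₂ hr₂l
  obtain ⟨hr₃', hr₃l'⟩ := hrB hV₃S hr₃ hr₃l
  refine ⟨invFunOn TZ₀ S, ?_, fun z hz => hinj.leftInvOn_invFunOn hz⟩
  exact Patching.contMDiffOn_leftInverse_of_three (g₁ := TZ₀) (g₂ := TZ₀) (g₃ := TZ₀) hcover hU₁S hU₂S hU₃S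
    (fun _ _ => rfl) (fun _ _ => rfl) (fun _ _ => rfl) (hoS hU₁S hU₁o) (hoS hU₂S hU₂o) (hoS hU₃S hU₃o)
    hr₁ hr₁l hr₂' hr₂l' hr₃' hr₃l' (fun z hz => hinj.leftInvOn_invFunOn hz)

/-! ### §3 The tube of `Σ̄₂` -/

include hρ₀ hi₁ hi₂ hUG hΦAs hΦAi hΦAo hΦBs hΦBo hΦBG hΦBi hdisj in
/-- **The tube of the glued surface.**  Under the hypotheses of this file there is a smooth
embedding `TZ : F × ℝ² → Z`, `F = T #_{D_F} T′`, with open range, given on the two pieces by the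
two sheets with shrunk fibre, whose range is the union of the two sheets' images.
[cite: AkhmedovPark2010, §3] [cite: LeeSmoothManifolds2013, Prop. 4.22] -/
theorem exists_glued_tube
    (hΦAr : ∃ rA : Z → F × EuclideanSpace ℝ (Fin 2),
      ContMDiffOn (𝓡 4) ((𝓡 2).prod (𝓡 2)) ∞ rA
        (ΦA '' ({p | p ≠ x₂} ×ˢ ball (0 : EuclideanSpace ℝ (Fin 2)) ρ₀)) ∧
      ∀ q ∈ {p | p ≠ x₂} ×ˢ ball (0 : EuclideanSpace ℝ (Fin 2)) ρ₀, rA (ΦA q) = q)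
    (hV₂ : IsOpen V₂) (hV₃ : IsOpen V₃)
    (hV₂S : V₂ ⊆ {w | w ≠ y₂} ×ˢ ball (0 : EuclideanSpace ℝ (Fin 2)) ρ₀)
    (hV₃S : V₃ ⊆ {w | w ≠ y₂} ×ˢ ball (0 : EuclideanSpace ℝ (Fin 2)) ρ₀)
    (hr₂ : ∃ r₂ : Z → F' × EuclideanSpace ℝ (Fin 2),
      ContMDiffOn (𝓡 4) ((𝓡 2).prod (𝓡 2)) ∞ r₂ (ΦB '' V₂) ∧ ∀ q ∈ V₂, r₂ (ΦB q) = q)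
    (hr₃ : ∃ r₃ : Z → F' × EuclideanSpace ℝ (Fin 2),
      ContMDiffOn (𝓡 4) ((𝓡 2).prod (𝓡 2)) ∞ r₃ (ΦB '' V₃) ∧ ∀ q ∈ V₃, r₃ (ΦB q) = q)
    (hcoverB : ∀ q : F' × EuclideanSpace ℝ (Fin 2), q.1 ≠ y₂ → ‖q.2‖ < ρ₀ →
      q.1 ∈ UG ∨ q ∈ V₂ ∨ q ∈ V₃) :
    ∃ TZ : DF.Glued hn × EuclideanSpace ℝ (Fin 2) → Z,
      Manifold.IsSmoothEmbedding ((𝓘(ℝ, EuclideanSpace ℝ (Fin 2))).prod (𝓡 2)) (𝓡 4) ∞ TZ ∧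
      IsOpen (range TZ) ∧
      (∀ (a : DF.A) (v : EuclideanSpace ℝ (Fin 2)), TZ ((DF.glueData hn).inl a, v) =
        ΦA (a, OpenPartialHomeomorph.univBall (0 : EuclideanSpace ℝ (Fin 2)) ρ₀ v)) ∧
      (∀ (b : DF.B) (v : EuclideanSpace ℝ (Fin 2)), TZ ((DF.glueData hn).inr b, v) =
        ΦB (b, OpenPartialHomeomorph.univBall (0 : EuclideanSpace ℝ (Fin 2)) ρ₀ v)) ∧
      range TZ = ΦA '' ({p | p ≠ x₂} ×ˢ ball (0 : EuclideanSpace ℝ (Fin 2)) ρ₀) ∪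
        ΦB '' ({w | w ≠ y₂} ×ˢ ball (0 : EuclideanSpace ℝ (Fin 2)) ρ₀) := by
  have hmem := mem_pieces (DF := DF) hi₁ hi₂
  obtain ⟨TZ₀, hTA, hTB⟩ := exists_TZ₀ (hn := hn) hUG hΦBG
  obtain ⟨rA, hrA, hrAl⟩ := hΦAr
  obtain ⟨r₂, hr₂, hr₂l⟩ := hr₂
  obtain ⟨r₃, hr₃, hr₃l⟩ := hr₃
  have hsm := contMDiffOn_TZ₀ hi₁ hi₂ hΦAs hΦBs hTA hTB
  have hinj := injOn_TZ₀ hi₁ hi₂ hUG hΦAi hΦBi hdisj hTA hTB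
  obtain ⟨r, hr, hrl⟩ := exists_inverse_TZ₀ hi₁ hi₂ hUG hΦAi hΦAo hΦBo hΦBi hdisj hTA hTB
    hrA hrAl hV₂ hV₃ hV₂S hV₃S hr₂ hr₂l hr₃ hr₃l hcoverB
  -- the fibre shrink
  set σ := OpenPartialHomeomorph.univBall (0 : EuclideanSpace ℝ (Fin 2)) ρ₀ with hσ
  have hσsrc : σ.source = univ := OpenPartialHomeomorph.univBall_source _ _
  have hσtgt : σ.target = ball 0 ρ₀ := OpenPartialHomeomorph.univBall_target _ hρ₀
  have hσmem : ∀ v, σ v ∈ ball (0 : EuclideanSpace ℝ (Fin 2)) ρ₀ := fun v => by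
    rw [← hσtgt]; exact σ.map_source (by rw [hσsrc]; exact mem_univ v)
  have hσsm : ContMDiff (𝓡 2) (𝓡 2) ∞ σ := OpenPartialHomeomorph.contDiff_univBall.contMDiff
  have hσsymm : ContMDiffOn (𝓡 2) (𝓡 2) ∞ σ.symm (ball 0 ρ₀) :=
    OpenPartialHomeomorph.contDiffOn_univBall_symm.contMDiffOn
  set S : Set (DF.Glued hn × EuclideanSpace ℝ (Fin 2)) :=
    (univ : Set (DF.Glued hn)) ×ˢ ball (0 : EuclideanSpace ℝ (Fin 2)) ρ₀ with hS
  let TZ : DF.Glued hn × EuclideanSpace ℝ (Fin 2) → Z := fun z => TZ₀ (z.1, σ z.2)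
  have hshr : ∀ z : DF.Glued hn × EuclideanSpace ℝ (Fin 2), (z.1, σ z.2) ∈ S := fun z =>
    ⟨mem_univ _, hσmem z.2⟩
  have hshr_sm : ContMDiff ((𝓘(ℝ, EuclideanSpace ℝ (Fin 2))).prod (𝓡 2))
      ((𝓘(ℝ, EuclideanSpace ℝ (Fin 2))).prod (𝓡 2)) ∞
      (fun z : DF.Glued hn × EuclideanSpace ℝ (Fin 2) => (z.1, σ z.2)) :=
    contMDiff_id.prodMap hσsm
  -- smoothness
  have hTZsm : ContMDiff ((𝓘(ℝ, EuclideanSpace ℝ (Fin 2))).prod (𝓡 2)) (𝓡 4) ∞ TZ :=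
    hsm.comp_contMDiff hshr_sm hshr
  -- injectivity
  have hσinj : Injective σ := fun v w h =>
    σ.injOn (by rw [hσsrc]; exact mem_univ v) (by rw [hσsrc]; exact mem_univ w) h
  have hTZinj : Injective TZ := by
    intro z z' h
    obtain ⟨h1, h2⟩ := Prod.mk.inj (hinj (hshr z) (hshr z') h)
    exact Prod.ext h1 (hσinj h2)
  -- open map
  have hTZopen : IsOpenMap TZ := by
    intro O hO
    set E : OpenPartialHomeomorph (DF.Glued hn × EuclideanSpace ℝ (Fin 2))
        (DF.Glued hn × EuclideanSpace ℝ (Fin 2)) := (OpenPartialHomeomorph.refl _).prod σ with hE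
    have hEO : IsOpen (E '' O) := E.isOpen_image_of_subset_source hO (by
      rw [hE, OpenPartialHomeomorph.prod_source, OpenPartialHomeomorph.refl_source, hσsrc, univ_prod_univ]
      exact subset_univ _)
    have himg : TZ '' O = TZ₀ '' (E '' O) := by
      rw [image_image]
      rfl
    rw [himg]
    refine (isOpen_image_TZ₀ hi₁ hi₂ hΦAo hΦBo hTA hTB hEO ?_).1
    rintro _ ⟨z, -, rfl⟩; exact hshr z
  -- left inverse
  have hrange : range TZ = TZ₀ '' S := by
    apply Subset.antisymm
    · rintro _ ⟨z, rfl⟩; exact ⟨_, hshr z, rfl⟩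
    · rintro _ ⟨⟨g, v⟩, ⟨-, hv⟩, rfl⟩
      refine ⟨(g, σ.symm v), ?_⟩
      show TZ₀ (g, σ (σ.symm v)) = TZ₀ (g, v)
      rw [σ.right_inv (by rw [hσtgt]; exact hv)]
  have hfinv : ContMDiffOn (𝓡 4) ((𝓘(ℝ, EuclideanSpace ℝ (Fin 2))).prod (𝓡 2)) ∞
      ((fun z : DF.Glued hn × EuclideanSpace ℝ (Fin 2) => (z.1, σ.symm z.2)) ∘ r) (range TZ) := by
    rw [hrange]
    have h1 : ContMDiffOn ((𝓘(ℝ, EuclideanSpace ℝ (Fin 2))).prod (𝓡 2))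
        ((𝓘(ℝ, EuclideanSpace ℝ (Fin 2))).prod (𝓡 2)) ∞
        (fun z : DF.Glued hn × EuclideanSpace ℝ (Fin 2) => (z.1, σ.symm z.2)) S :=
      contMDiffOn_id.prodMap hσsymm
    refine h1.comp hr ?_
    rintro _ ⟨z, hz, rfl⟩
    rw [mem_preimage, hrl z hz]; exact hz
  have hleft : ∀ z, ((fun z : DF.Glued hn × EuclideanSpace ℝ (Fin 2) => (z.1, σ.symm z.2)) ∘ r) (TZ z) = z := by
    intro z
    show ((r (TZ₀ (z.1, σ z.2))).1, σ.symm (r (TZ₀ (z.1, σ z.2))).2) = z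
    rw [hrl _ (hshr z)]
    exact Prod.ext rfl (σ.left_inv (by rw [hσsrc]; exact mem_univ _))
  have L : (EuclideanSpace ℝ (Fin 2) × EuclideanSpace ℝ (Fin 2)) ≃L[ℝ] EuclideanSpace ℝ (Fin 4) :=
    ContinuousLinearEquiv.ofFinrankEq (by simp)
  obtain ⟨hemb, hopen⟩ := isSmoothEmbedding_of_leftInverse_of_isOpenMap hTZsm hTZinj hTZopen hfinv hleft L
  refine ⟨TZ, hemb, hopen, fun a v => hTA a (σ v), fun b v => hTB b (σ v), ?_⟩
  rw [hrange, (isOpen_image_TZ₀ hi₁ hi₂ hΦAo hΦBo hTA hTB (isOpen_univ.prod isOpen_ball) le_rfl).2]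
  congr 1
  · congr 1
    apply Subset.antisymm
    · rintro _ ⟨⟨a, v⟩, ⟨-, hv⟩, rfl⟩; exact ⟨(hmem a (DF.i₂ 0)).1.1 a.2, hv⟩
    · rintro ⟨p, v⟩ ⟨hp, hv⟩
      exact ⟨(⟨p, (hmem p (DF.i₂ 0)).1.2 hp⟩, v), ⟨mem_univ _, hv⟩, rfl⟩
  · congr 1
    apply Subset.antisymm
    · rintro _ ⟨⟨b, v⟩, ⟨-, hv⟩, rfl⟩; exact ⟨(hmem (DF.i₁ 0) b).2.1 b.2, hv⟩
    · rintro ⟨w, v⟩ ⟨hw, hv⟩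
      exact ⟨(⟨w, (hmem (DF.i₁ 0) w).2.2 hw⟩, v), ⟨mem_univ _, hv⟩, rfl⟩

end TubeDescent

end Literature.Topology.FourManifolds
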